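import Summits.Ventures.CertifiedQuantumChemistry.Rows.SOSDualCert
import HarnessLib

/-!
# Ventures/CertifiedQuantumChemistry — Rows/SOSDualSemantics.lean: what the term lists of `Rows/SOSDualCert.lean` denote
# (part 2 of 3 of the kernel replay of an SDP dual lower certificate)

HONEST FRAMING (verbatim): certified bounds for a stated model Hamiltonian in a stated basis; not a
claim about the real molecule beyond that model.

var-2 (gen 17), zero compute, PROVED glue only (0 sorry, no claim node, no model instance, NO BOUND ASSERTED).

* `termOp T = Σ_t c_t • ladderWord w_t` and `evalPoly id (termsToPoly T) = termOp T`, `evalPoly id (normalize … T) =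
  termOp T` (the engine's soundness with the identity letter map), `termOp` of `append` / `negTerms` / `dropZero` /
  `flatMap`, `sum_map_finList` (list sums ↔ `Finset.univ` sums), `ladderWord_append'`, `ladderWord_dagger`
  (`ladderWord (dagger w) = (ladderWord w)ᴴ`);
* **`termOp_hamTerms : termOp (hamTerms F) = F.hamiltonian − E_core • 1`** (from `molecularHamiltonian_eq`);
* **`re_gramTermsOf_nonneg`**: `0 ≤ Re ⟨v, termOp (gramTermsOf K PL) v⟩` for EVERY (word, integer-row) list `PL` —
  `Σ_{XY} dotZ(L_X, L_Y) ⟨O_X v, O_Y v⟩ = Σ_t ‖Σ_X (L_X)_t O_X v‖²`, proved by peeling columns (`dotZ_peel`, `gramQ_peel`,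
  `gramQ_re_nonneg`; no matrix is ever formed, ragged rows allowed).
-/

namespace Summit.Ventures.CertifiedQuantumChemistry

open Matrix
open Literature.MathematicalPhysics.QuantumLattice Literature.MathematicalPhysics.QuantumChemistry
open CARPoly
open scoped ComplexOrder

namespace SOSDual

/-! ## Semantics of term lists -/

section Semantics

variable {k : ℕ}

/-- The operator a term list denotes: `Σ_t c_t · ladderWord w_t`. -/
noncomputable def termOp (T : Terms k) : Op k := (T.map fun wc => ((wc.2 : ℚ) : ℂ) • ladderWord wc.1).sum

omit k in
/-- The identity letter map does nothing to a word. -/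
theorem wmap_id {ι : Type*} (w : List (ι × Bool)) : wmap id w = w := by
  induction w with
  | nil => rfl
  | cons l w ih => rw [wmap_cons, ih]; rfl

/-- `evalPoly id (termsToPoly T) = termOp T` (the engine's soundness with the identity letter map). -/
theorem evalPoly_termsToPoly_id (T : Terms k) : evalPoly id (termsToPoly T) = termOp T := by
  rw [evalPoly_termsToPoly Function.injective_id]
  unfold termOp
  congr 1
  refine List.map_congr_left fun wc _ => ?_
  rw [wmap_id]

/-- `evalPoly id (normalize … T) = termOp T`. -/
theorem evalPoly_normalize_id (enc : Orb (Fin k) → ℕ) (B : ℕ) (T : Terms k) :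
    evalPoly id (normalize enc B T) = termOp T := by
  rw [CARPoly.normalize, evalPoly_collect, evalPoly_termsToPoly_id]

/-- The empty term list denotes `0`. -/
@[simp] theorem termOp_nil : termOp ([] : Terms k) = 0 := rfl

/-- `termOp` of a cons. -/
theorem termOp_cons (wc : List (Orb (Fin k) × Bool) × ℚ) (T : Terms k) :
    termOp (wc :: T) = ((wc.2 : ℚ) : ℂ) • ladderWord wc.1 + termOp T := rfl

/-- `termOp` is additive under concatenation. -/
theorem termOp_append (A B : Terms k) : termOp (A ++ B) = termOp A + termOp B := by
  simp [termOp, List.map_append, List.sum_append]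

/-- Negated coefficients denote the negated operator. -/
theorem termOp_negTerms (T : Terms k) : termOp (negTerms T) = -termOp T := by
  induction T with
  | nil => simp [negTerms]
  | cons wc T ih =>
    have h : negTerms (wc :: T) = (wc.1, -wc.2) :: negTerms T := rfl
    rw [h, termOp_cons, termOp_cons, ih, Rat.cast_neg, neg_smul, neg_add]

/-- Dropping zero coefficients does not change the operator. -/
theorem termOp_dropZero (T : Terms k) : termOp (dropZero T) = termOp T := by
  induction T with
  | nil => simp [dropZero]
  | cons wc T ih =>
    unfold dropZero at ih ⊢
    rw [List.filter_cons]
    by_cases h : wc.2 ≠ 0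
    · rw [if_pos (by simpa using h), termOp_cons, termOp_cons, ih]
    · rw [if_neg (by simpa using h), termOp_cons, ih, not_not.1 h, Rat.cast_zero, zero_smul, zero_add]

/-- `termOp` of a `flatMap` is the sum of the pieces. -/
theorem termOp_flatMap {β : Type*} (L : List β) (f : β → Terms k) :
    termOp (L.flatMap f) = (L.map fun b => termOp (f b)).sum := by
  induction L with
  | nil => rfl
  | cons b L ih => rw [List.flatMap_cons, termOp_append, ih, List.map_cons, List.sum_cons]

/-- `termOp` of a list of single terms. -/
theorem termOp_map_single {β : Type*} (L : List β) (w : β → List (Orb (Fin k) × Bool)) (c : β → ℚ) :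
    termOp (L.map fun b => (w b, c b)) = (L.map fun b => ((c b : ℚ) : ℂ) • ladderWord (w b)).sum := by
  induction L with
  | nil => rfl
  | cons b L ih => rw [List.map_cons, termOp_cons, ih, List.map_cons, List.sum_cons]

/-- `Σ` over `finList n` is the `Finset.univ` sum over `Fin n`. -/
theorem sum_map_finList {M : Type*} [AddCommMonoid M] : ∀ (n : ℕ) (f : Fin n → M),
    ((finList n).map f).sum = ∑ i : Fin n, f i
  | 0, f => by simp [finList]
  | n + 1, f => by
    rw [finList, List.map_cons, List.sum_cons, List.map_map, sum_map_finList n, Fin.sum_univ_succ]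
    rfl

/-! ### Ladder words: concatenation and adjoint -/

/-- A concatenated word denotes the product. -/
theorem ladderWord_append' {ι : Type*} [LinearOrder ι] [Fintype ι] (w w' : List (ι × Bool)) :
    ladderWord (w ++ w') = ladderWord w * ladderWord w' := by
  simp [ladderWord, List.map_append, List.prod_append]

/-- The adjoint of a ladder letter is the flipped letter. -/
theorem conjTranspose_ladderLetter {ι : Type*} [LinearOrder ι] [Fintype ι] (l : ι × Bool) :
    (ladderLetter l)ᴴ = ladderLetter (l.1, !l.2) := by
  obtain ⟨i, b⟩ := l
  cases b
  · simp [ladderLetter, annihilation_conjTranspose]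
  · simp [ladderLetter, creation_conjTranspose]

/-- The reversed, flipped word denotes the adjoint: `ladderWord (dagger w) = (ladderWord w)ᴴ`. -/
theorem ladderWord_dagger {ι : Type*} [LinearOrder ι] [Fintype ι] (w : List (ι × Bool)) :
    ladderWord (dagger w) = (ladderWord w)ᴴ := by
  induction w with
  | nil => simp [dagger, ladderWord]
  | cons l w ih =>
    have h : dagger (l :: w) = dagger w ++ [(l.1, !l.2)] := by simp [dagger]
    rw [h, ladderWord_append', ih, ladderWord_cons l w, conjTranspose_mul, ladderWord_cons, ladderWord_nil, mul_one,
      conjTranspose_ladderLetter]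

/-! ### The Hamiltonian term list -/

/-- The one-body term list denotes `Σ_{pq} h_pq Σ_σ a†_{pσ} a_{qσ}`. -/
theorem termOp_oneBodyTerms (F : Model k) :
    termOp (oneBodyTerms F) = ∑ p : Fin k, ∑ q : Fin k, ((F.h p q : ℚ) : ℂ) •
      ∑ σ : Fin 2, creation (orb p σ) * annihilation (orb q σ) := by
  unfold oneBodyTerms
  rw [termOp_flatMap, sum_map_finList]
  refine Finset.sum_congr rfl fun p _ => ?_
  rw [termOp_flatMap, sum_map_finList]
  refine Finset.sum_congr rfl fun q _ => ?_
  rw [termOp_map_single, sum_map_finList, Finset.smul_sum]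
  refine Finset.sum_congr rfl fun σ _ => ?_
  simp [ladderWord_cons, ladderLetter]

/-- The two-body term list denotes `½ Σ_{pqrs} (pq|rs) Σ_{στ} a†_{pσ} a†_{rτ} a_{sτ} a_{qσ}`. -/
theorem termOp_twoBodyTerms (F : Model k) :
    termOp (twoBodyTerms F) = (1 / 2 : ℂ) • ∑ p : Fin k, ∑ q : Fin k, ∑ r : Fin k, ∑ s : Fin k,
      ((F.eri p q r s : ℚ) : ℂ) • ∑ σ : Fin 2, ∑ τ : Fin 2,
        creation (orb p σ) * creation (orb r τ) * annihilation (orb s τ) * annihilation (orb q σ) := by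
  unfold twoBodyTerms
  rw [Finset.smul_sum, termOp_flatMap, sum_map_finList]
  refine Finset.sum_congr rfl fun p _ => ?_
  rw [Finset.smul_sum, termOp_flatMap, sum_map_finList]
  refine Finset.sum_congr rfl fun q _ => ?_
  rw [Finset.smul_sum, termOp_flatMap, sum_map_finList]
  refine Finset.sum_congr rfl fun r _ => ?_
  rw [Finset.smul_sum, termOp_flatMap, sum_map_finList]
  refine Finset.sum_congr rfl fun s _ => ?_
  rw [smul_smul, Finset.smul_sum, termOp_flatMap, sum_map_finList]
  refine Finset.sum_congr rfl fun σ _ => ?_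
  rw [Finset.smul_sum, termOp_map_single, sum_map_finList]
  refine Finset.sum_congr rfl fun τ _ => ?_
  rw [Rat.cast_div, Rat.cast_ofNat]
  simp only [ladderWord_cons, ladderWord_nil, ladderLetter, if_true, Bool.false_eq_true, if_false, mul_one,
    Matrix.mul_assoc]
  congr 1
  ring

/-- **The model's term list denotes `H_F − E_core·1`.** -/
theorem termOp_hamTerms (F : Model k) : termOp (hamTerms F) = F.hamiltonian - (F.ecore : ℂ) • (1 : Op k) := by
  rw [hamTerms, termOp_dropZero, termOp_append, termOp_oneBodyTerms, termOp_twoBodyTerms, Model.hamiltonian,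
    molecularHamiltonian_eq, add_sub_cancel_right]

end Semantics

/-! ### List-sum bookkeeping -/

section ListSums

variable {m : Type*} [Fintype m] {β : Type*}

/-- `⬝ᵥ` distributes over a list sum on the right. -/
theorem dotProduct_listSum (v : m → ℂ) (L : List β) (g : β → m → ℂ) :
    v ⬝ᵥ (L.map g).sum = (L.map fun b => v ⬝ᵥ g b).sum := by
  induction L with
  | nil => simp
  | cons b L ih => rw [List.map_cons, List.sum_cons, dotProduct_add, ih, List.map_cons, List.sum_cons]

/-- `⬝ᵥ` distributes over a list sum on the left. -/
theorem listSum_dotProduct (L : List β) (g : β → m → ℂ) (v : m → ℂ) :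
    (L.map g).sum ⬝ᵥ v = (L.map fun a => g a ⬝ᵥ v).sum := by
  induction L with
  | nil => simp
  | cons b L ih => rw [List.map_cons, List.sum_cons, add_dotProduct, ih, List.map_cons, List.sum_cons]

omit [Fintype m] in
/-- `star` of a list sum of vectors. -/
theorem star_listSum (L : List β) (g : β → m → ℂ) : star (L.map g).sum = (L.map fun a => star (g a)).sum := by
  induction L with
  | nil => simp
  | cons b L ih => rw [List.map_cons, List.sum_cons, star_add, ih, List.map_cons, List.sum_cons]

/-- `*ᵥ` distributes over a list sum of matrices. -/
theorem listSum_mulVec [DecidableEq m] (L : List β) (g : β → Matrix m m ℂ) (v : m → ℂ) :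
    (L.map g).sum *ᵥ v = (L.map fun a => g a *ᵥ v).sum := by
  induction L with
  | nil => simp
  | cons b L ih => rw [List.map_cons, List.sum_cons, Matrix.add_mulVec, ih, List.map_cons, List.sum_cons]

omit [Fintype m] in
/-- List sum of a pointwise sum. -/
theorem listSum_map_add (L : List β) (f g : β → ℂ) : (L.map fun x => f x + g x).sum = (L.map f).sum + (L.map g).sum := by
  induction L with
  | nil => simp
  | cons b L ih => simp only [List.map_cons, List.sum_cons, ih]; ring

omit [Fintype m] in
/-- Real part of a list sum. -/
theorem re_listSum (L : List β) (g : β → ℂ) : (L.map g).sum.re = (L.map fun a => (g a).re).sum := by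
  induction L with
  | nil => simp
  | cons b L ih => rw [List.map_cons, List.sum_cons, Complex.add_re, ih, List.map_cons, List.sum_cons]

end ListSums

/-! ### Gram blocks: `Σ_{XY} (L Lᵀ)[X,Y] ⟨O_X ψ, O_Y ψ⟩ ≥ 0` by peeling columns -/

section Gram

variable {m : Type*} [Fintype m]

/-- First entry or `0`. -/
def hd0 : List ℤ → ℤ
  | [] => 0
  | x :: _ => x

omit m in
/-- `dotZ [] s = 0`. -/
theorem dotZ_nil_left (s : List ℤ) : dotZ [] s = 0 := by cases s <;> rfl

omit m in
/-- `dotZ r [] = 0`. -/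
theorem dotZ_nil_right (r : List ℤ) : dotZ r [] = 0 := by cases r <;> rfl

omit m in
/-- Column peeling: `⟨r, s⟩ = r₀ s₀ + ⟨tail r, tail s⟩` (with `0` heads / empty tails for exhausted rows). -/
theorem dotZ_peel (r s : List ℤ) : dotZ r s = hd0 r * hd0 s + dotZ r.tail s.tail := by
  cases r with
  | nil => rw [dotZ_nil_left, hd0, zero_mul, zero_add, List.tail_nil, dotZ_nil_left]
  | cons x xs =>
    cases s with
    | nil => rw [dotZ_nil_right, hd0, hd0, mul_zero, zero_add, List.tail_nil, dotZ_nil_right]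
    | cons y ys => rfl

/-- The Gram quadratic form `Σ_{a,b} dotZ(a₂, b₂) · ⟨a₁, b₁⟩` of a list of (vector, integer row) pairs. -/
noncomputable def gramQ (L : List ((m → ℂ) × List ℤ)) : ℂ :=
  (L.map fun a => (L.map fun b => ((dotZ a.2 b.2 : ℤ) : ℂ) * (star a.1 ⬝ᵥ b.1)).sum).sum

/-- The column vector `Σ_a (a₂)₀ · a₁`. -/
noncomputable def colVec (L : List ((m → ℂ) × List ℤ)) : m → ℂ := (L.map fun a => ((hd0 a.2 : ℤ) : ℂ) • a.1).sum

/-- `⟨colVec, colVec⟩ = Σ_{a,b} (a₂)₀ (b₂)₀ ⟨a₁, b₁⟩`. -/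
theorem star_colVec_dotProduct_colVec (L : List ((m → ℂ) × List ℤ)) :
    star (colVec L) ⬝ᵥ colVec L =
      (L.map fun a => (L.map fun b => ((hd0 a.2 * hd0 b.2 : ℤ) : ℂ) * (star a.1 ⬝ᵥ b.1)).sum).sum := by
  unfold colVec
  rw [star_listSum, listSum_dotProduct]
  congr 1
  refine List.map_congr_left fun a _ => ?_
  rw [star_smul, smul_dotProduct, dotProduct_listSum, smul_eq_mul, ← List.sum_map_mul_left]
  congr 1
  refine List.map_congr_left fun b _ => ?_
  rw [dotProduct_smul, smul_eq_mul, Int.cast_mul, Complex.star_def, map_intCast]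
  ring

/-- Double list sum. -/
noncomputable def dsum {γ : Type*} (L : List γ) (f : γ → γ → ℂ) : ℂ := (L.map fun a => (L.map fun b => f a b).sum).sum

omit [Fintype m] in
/-- A double sum of a pointwise sum splits. -/
theorem dsum_add {γ : Type*} (L : List γ) (f g : γ → γ → ℂ) :
    dsum L (fun a b => f a b + g a b) = dsum L f + dsum L g := by
  unfold dsum
  rw [← listSum_map_add]
  congr 1
  refine List.map_congr_left fun a _ => ?_
  exact listSum_map_add L _ _

omit [Fintype m] in
/-- A double sum over a mapped list. -/
theorem dsum_map {γ δ : Type*} (L : List γ) (φ : γ → δ) (f : δ → δ → ℂ) :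
    dsum (L.map φ) f = dsum L (fun a b => f (φ a) (φ b)) := by
  simp [dsum, List.map_map, Function.comp_def]

/-- Peeling one column off the quadratic form. -/
theorem gramQ_peel (L : List ((m → ℂ) × List ℤ)) :
    gramQ L = star (colVec L) ⬝ᵥ colVec L + gramQ (L.map fun a => (a.1, a.2.tail)) := by
  have h1 : gramQ L = dsum L (fun a b => ((hd0 a.2 * hd0 b.2 : ℤ) : ℂ) * (star a.1 ⬝ᵥ b.1) +
      ((dotZ a.2.tail b.2.tail : ℤ) : ℂ) * (star a.1 ⬝ᵥ b.1)) := by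
    unfold gramQ dsum
    congr 1
    refine List.map_congr_left fun a _ => ?_
    congr 1
    refine List.map_congr_left fun b _ => ?_
    rw [dotZ_peel, Int.cast_add]
    ring
  have h2 : gramQ (L.map fun a => (a.1, a.2.tail)) =
      dsum L (fun a b => ((dotZ a.2.tail b.2.tail : ℤ) : ℂ) * (star a.1 ⬝ᵥ b.1)) := by
    unfold gramQ
    exact dsum_map L _ _
  rw [h1, dsum_add, star_colVec_dotProduct_colVec, h2]
  rfl

/-- All rows exhausted: the form vanishes. -/
theorem gramQ_eq_zero_of_nil (L : List ((m → ℂ) × List ℤ)) (h : ∀ a ∈ L, a.2 = []) : gramQ L = 0 := by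
  unfold gramQ
  refine List.sum_eq_zero fun x hx => ?_
  obtain ⟨a, ha, rfl⟩ := List.mem_map.1 hx
  refine List.sum_eq_zero fun y hy => ?_
  obtain ⟨b, -, rfl⟩ := List.mem_map.1 hy
  rw [h a ha, dotZ_nil_left, Int.cast_zero, zero_mul]

/-- **Positivity of the integer Gram form**: `0 ≤ Re Σ_{a,b} dotZ(a₂,b₂) ⟨a₁,b₁⟩` (`= Σ_t ‖colVec_t‖²`). -/
theorem gramQ_re_nonneg : ∀ (n : ℕ) (L : List ((m → ℂ) × List ℤ)), (∀ a ∈ L, a.2.length ≤ n) → 0 ≤ (gramQ L).re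
  | 0, L, h => by
    rw [gramQ_eq_zero_of_nil L fun a ha => List.eq_nil_of_length_eq_zero (Nat.le_zero.1 (h a ha)), Complex.zero_re]
  | n + 1, L, h => by
    rw [gramQ_peel, Complex.add_re]
    have h1 : 0 ≤ (star (colVec L) ⬝ᵥ colVec L).re := (Complex.nonneg_iff.1 (dotProduct_star_self_nonneg _)).1
    have h2 := gramQ_re_nonneg n (L.map fun a => (a.1, a.2.tail)) fun a ha => by
      obtain ⟨a', ha', rfl⟩ := List.mem_map.1 ha
      simp only [List.length_tail]
      have := h a' ha'
      omega
    linarith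

variable {k : ℕ}

/-- The Gram term list of a (word, row) list denotes `Σ_{a,b} (dotZ(a₂,b₂)/4^K) · (O_a)ᴴ O_b`. -/
theorem termOp_gramTermsOf (K : ℕ) (PL : List (List (Orb (Fin k) × Bool) × List ℤ)) :
    termOp (gramTermsOf K PL) = (PL.map fun a => (PL.map fun b =>
      (((dotZ a.2 b.2 : ℚ) / 4 ^ K : ℚ) : ℂ) • ((ladderWord a.1)ᴴ * ladderWord b.1)).sum).sum := by
  unfold gramTermsOf
  rw [termOp_flatMap]
  congr 1
  refine List.map_congr_left fun a _ => ?_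
  rw [termOp_map_single]
  congr 1
  refine List.map_congr_left fun b _ => ?_
  rw [ladderWord_append', ladderWord_dagger]

/-- **The Gram part is nonnegative on every vector.** -/
theorem re_gramTermsOf_nonneg (K : ℕ) (PL : List (List (Orb (Fin k) × Bool) × List ℤ))
    (v : Finset (Orb (Fin k)) → ℂ) : 0 ≤ (star v ⬝ᵥ (termOp (gramTermsOf K PL) *ᵥ v)).re := by
  have key : star v ⬝ᵥ (termOp (gramTermsOf K PL) *ᵥ v) =
      (((1 : ℚ) / 4 ^ K : ℚ) : ℂ) * gramQ (PL.map fun a => (ladderWord a.1 *ᵥ v, a.2)) := by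
    rw [termOp_gramTermsOf, listSum_mulVec, dotProduct_listSum, gramQ, List.map_map, ← List.sum_map_mul_left]
    congr 1
    refine List.map_congr_left fun a _ => ?_
    rw [Function.comp_apply, listSum_mulVec, dotProduct_listSum, List.map_map, ← List.sum_map_mul_left]
    congr 1
    refine List.map_congr_left fun b _ => ?_
    rw [Function.comp_apply, Matrix.smul_mulVec, dotProduct_smul, smul_eq_mul, ← mulVec_mulVec, dotProduct_mulVec,
      ← star_mulVec]
    push_cast
    ring
  rw [key]
  have hc : (((1 : ℚ) / 4 ^ K : ℚ) : ℂ) = ((((1 : ℚ) / 4 ^ K : ℚ) : ℝ) : ℂ) := (Complex.ofReal_ratCast _).symm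
  rw [hc, Complex.re_ofReal_mul]
  refine mul_nonneg (by positivity) (gramQ_re_nonneg ((PL.map fun a => a.2.length).sum) _ fun a ha => ?_)
  obtain ⟨a', ha', rfl⟩ := List.mem_map.1 ha
  show a'.2.length ≤ _
  exact List.single_le_sum (fun _ _ => Nat.zero_le _) _ (List.mem_map.2 ⟨a', ha', rfl⟩)

end Gram

end SOSDual

end Summit.Ventures.CertifiedQuantumChemistry
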